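/-
Copyright: the b2b-balaban T⁴-continuum CRUX team, row NE7b OWNER lineage `t4-ne7b-p1` (gen 125). Project licence.
-/
import Summits.QuantumFields.BalabanUV.T4Continuum.Spine.NE7b.SupZdKernelSections
import Summits.QuantumFields.BalabanUV.T4Continuum.Spine.NE7b.SupZdCoarseInverseTorusLimit

/-!
# KERNEL ALGEBRA, VIII: A TORUS KERNEL CLOSE TO THE WINDOW READING OF A `ℤ^d` KERNEL HAS ITS INVERSE CLOSE TO THE `ℤ^d` DECAYING INVERSE.
# On the coarse torus `Site d (3^k)` with its `ℓ¹` metric `ρ`: `Tt` symmetric with a floor `γ_t` and decay `C_te^{−κρ}`; `T` a symmetric `ℤ^d`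
# kernel with a floor `γ_z` on finite supports and decay `C_ze^{−δ_z|b−c|₁}`, `N` ANY decaying kernel with `TN = 1`; and the ROW SEAM bound
# `|Tt(y,y′) − T(wm y, wm y′)| ≤ C_se^{−δ_sω(y)}`, `ω(y) = max(0, (3^k∕2 − 2 − |wm y|₁)∕2)` ⟹
# `|Tt⁻¹(y,y′) − N(wm y, wm y′)| ≤ c₁e^{−δ₁(ω y + ω y′)} + C′(e^{−(ν′∕2)((3^k−1)∕2 − |wm y|₁)} + e^{−(ν′∕2)((3^k−1)∕2 − |wm y′|₁)})` with constants
# from `(γ_t, C_t, κ, γ_z, C_z, δ_z, C_s, δ_s, C_N, ν, d)` only — [B4] (5.6) for `Tt` and for `T∘wm` ((236) §1 pulled back along `wm`), (5.9) by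
# the geometric mean of the row bound, the column bound (symmetry) and plain decay ((198)'s device), (5.10) by `sect5Uniform_holds`; then
# `(T∘wm)⁻¹` IS the window-section inverse of `T` (`wm : Site ≃ W`), which (236)'s padded-section argument compares with `N` on the `ℓ¹`-ball
# inside the window.  The abstract form of (198)+(199); the `H + K` road instance (`Tt = T^{tor}_K`, `T = T_K`, `N = N_K`, seam (240)) is
# the sequel (row NE7b, node U5c; (198)∕(199)∕(229)∕(236) BY NAME; [folklore])

Cell `pub-balaban`, sub-cell `t4`, spine estimate NE7b (`T4WeightBudget.RelWeightBound`; the cell's OWN estimate — NOT PRINTED in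
[Bałaban 1983–89], NOT PROVED).  Crux-route work under `Spine/NE7b/` by the row OWNER (`t4-ne7b-p1` gen 125, file (241)) under FREEZE
(0)'s crux-prover clause; NOTHING of Bałaban's is named as a Lean object, valued or asserted; no `T4Continuum/Support` leaf typed; no `def`,
no notation; zero `sorry`; no road object (pure kernel algebra on the torus and `ℤ^d`).  Imports (BY NAME): the OWNER's (236)
`…SupZdKernelSections` (`kernel_section_hyp56`, `kernel_section_inverse`, `padded_left_inverse`, `padded_inverse_decay`, `padded_bound`;
through it (229) `inverse_ball_rate`, (194) `mem_cube_of_l1_le`, `natAbs_le_l1`), (199) `…SupZdCoarseInverseTorusLimit` (import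
closure: (198) `decay_weaken`, `abs_le_of_three`, (197) `torusNorm_eq_l1`, (180) `torusNorm_le_l1`, `inWindow_of_le`, SupTorusBlockDistance
`isPseudoDist_torus`, `sumBound_torus`, SupZdPropagatorProfile `torusDist_le_l1`, the torus dictionary), the Literature engine
`B4Sect5Torus` (`Hyp56`, `Hyp59`, `hyp56_submatrix`, `sect5Uniform_holds`), Mathlib's `Matrix.inv_submatrix_equiv`.

WHY (located).  The last step of the torus → `ℤ^d` identification of the perturbed next-scale Hessian is kernel algebra, and (198)∕(199)
did it for the linear column with the road's objects inlined.  Stated once abstractly it serves the `H + K` column (inputs: (165)∕(166) for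
`T^{tor}_K`'s symmetry∕floor∕decay, (234) for `T_K`'s, (222) for `N_K`, (240) for the seam) and any later column.  Two remarks make it
work without (194)'s cube-limit construction: (a) the matrix `T∘wm` on the torus index set is the `W`-section of `T` reindexed along the
bijection `wm : Site d (3^k) ≃ W` (so its inverse is the section inverse), and (b) the window contains the `ℓ¹`-ball of radius `(3^k−1)∕2`,
on which the padded section agrees with `T`, so (229) `inverse_ball_rate` bounds `(T_W)⁻¹ − N` in the margins — no cube needed.

WHAT IS PROVED ([folklore]): §1 `mem_window_of_l1_le` (the ball is in the window), **`window_section_close`** (`∃ c₂ δ₂`: for ALL symmetric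
`T` with floor∕decay and ALL decaying right inverses `N`: `|(T_W)⁻¹(b,b′) − N(b,b′)| ≤` the (229) bound with `R = (3^k−1)∕2`); §2 THE END
**`torus_inverse_close`** (as displayed above); §3 toy.

HONEST (what this is NOT).  Abstract kernel algebra; the road instance and the `k → ∞` corollary are the sequel; nothing of the covariant
propagators of [B4]–[B6]; nothing of Bałaban's asserted.  BY-NAME EFFECT ON THE WALL: NONE.  NE7b NOT PRINTED ∕ NOT PROVED; spine PROVED
0∕9; rung (B)+1 — the programme's measures remain FINITE-torus statements; NOT the mass gap, NOT Clay.  HONEST DEPENDENCY: continuum YM on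
T⁴ ⇐ BetaPertH ∧ nine spine estimates (0∕9 proved); BetaPertH ⇐ (D1) ∧ (D4) ∧ CAP+tail; G-an2-4 gates asym, D1 and NE2∕3∕4.
-/

set_option autoImplicit false

noncomputable section

namespace Summit.QuantumFields.BalabanUV.T4Continuum.NE7b.SupZdKernelTorusWindow

open Real Filter Topology
open Literature.MathematicalPhysics.QuantumFieldTheory.Balaban1983to89
open B6QGQLower276 (X)
open Beta (Site siteOf windowMap siteOf_windowMap windowMap_siteOf windowMap_injective InWindow inWindow_of_two_mul_abs_lt)
open B4Sect5Torus (IsPseudoDist SumBound Hyp56 Hyp59 hyp56_submatrix sect5Uniform_holds)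
open SupTorusBlockDistance (isPseudoDist_torus sumBound_torus)
open SupZdPropagatorProfile (torusDist_le_l1)
open SupZdPropagatorLimit (torusNorm_le_l1)
open SupZdCoarseInverse (natAbs_le_l1)
open SupZdCoarseTorusSeam (torusNorm_eq_l1)
open SupZdCoarseTorusHyp (decay_weaken abs_le_of_three)
open SupZdKernelInverseCubeRate (inverse_ball_rate)
open SupZdKernelSections (kernel_section_hyp56 kernel_section_inverse padded_left_inverse padded_inverse_decay padded_bound)

variable {d : ℕ}

/-! ## §1. The window contains the `ℓ¹`-ball; the window-section inverse is close to the decaying inverse -/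

/-- **THE `ℓ¹`-BALL OF RADIUS `(3^k−1)∕2` LIES IN THE WINDOW**: `|c|₁ ≤ (3^k−1)∕2` ⟹ `c = wm(σ c)` is a window point. [folklore] -/
theorem mem_window_of_l1_le (k : ℕ) (c : X d) (hc : ∑ i, (((c i - (0 : X d) i).natAbs : ℕ) : ℝ) ≤ (((3 ^ k : ℕ) : ℝ) - 1) / 2) :
    c ∈ (Finset.univ : Finset (Site d (3 ^ k))).image (windowMap d (3 ^ k)) := by
  classical
  have hc' : ∑ i, (((c i).natAbs : ℕ) : ℝ) ≤ (((3 ^ k : ℕ) : ℝ) - 1) / 2 := by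
    simpa only [Pi.zero_apply, sub_zero] using hc
  refine Finset.mem_image.2 ⟨siteOf d (3 ^ k) c, Finset.mem_univ _, windowMap_siteOf d (3 ^ k) fun i => ?_⟩
  refine inWindow_of_two_mul_abs_lt ?_
  have h1 : (((c i).natAbs : ℕ) : ℝ) ≤ ∑ j, (((c j).natAbs : ℕ) : ℝ) := by exact_mod_cast natAbs_le_l1 c i
  have h2 : ((2 * (c i).natAbs : ℕ) : ℝ) < ((3 ^ k : ℕ) : ℝ) := by
    rw [Nat.cast_mul, Nat.cast_ofNat]; linarith
  have h3 : 2 * (c i).natAbs < 3 ^ k := by exact_mod_cast h2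
  rw [← Int.natCast_natAbs]
  exact_mod_cast h3

/-- **THE WINDOW-SECTION INVERSE IS CLOSE TO THE DECAYING INVERSE**: `∃ c₂ δ₂ > 0` from `(γ, C, δ, d)` such that for EVERY symmetric `T`
with floor `γ` on finite supports and decay `(C, δ)`, EVERY decaying right inverse `N` (`C_N`, `ν`), every `k` and all `b, b′` in the window
`W`: `|(T_W)⁻¹(b,b′) − N(b,b′)| ≤ C′²K_{ν′}·2max(C,1)K_{ν′∕2}·(e^{−(ν′∕2)((3^k−1)∕2 − |b|₁)} + e^{−(ν′∕2)((3^k−1)∕2 − |b′|₁)})`, `ν′ = min(δ₂, ν)`,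
`C′ = max(max(c₂,1), C_N)` — (236)'s padded section on `W` against `N`, (229) on the ball of radius `(3^k−1)∕2 ⊆ W`. [folklore] -/
theorem window_section_close {γ C δ : ℝ} (hγ : 0 < γ) (hC : 0 < C) (hδ : 0 < δ) :
    ∃ c₂ δ₂ : ℝ, 0 < c₂ ∧ 0 < δ₂ ∧ ∀ (T N : X d → X d → ℝ) (CN ν : ℝ), 0 ≤ CN → 0 < ν →
      (∀ b c, T b c = T c b) →
      (∀ (S : Finset (X d)) (g : X d → ℝ), (∀ b, b ∉ S → g b = 0) →
        γ * ∑ b ∈ S, g b ^ 2 ≤ ∑ b ∈ S, g b * ∑ c ∈ S, T b c * g c) →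
      (∀ b c, |T b c| ≤ C * exp (-(δ * ∑ i, (((b i - c i).natAbs : ℕ) : ℝ)))) →
      (∀ b c, |N b c| ≤ CN * exp (-(ν * ∑ i, (((b i - c i).natAbs : ℕ) : ℝ)))) →
      (∀ b c, ∑' b' : X d, T b b' * N b' c = if b = c then 1 else 0) →
      ∀ (k : ℕ) (b b' : X d) (hb : b ∈ (Finset.univ : Finset (Site d (3 ^ k))).image (windowMap d (3 ^ k)))
        (hb' : b' ∈ (Finset.univ : Finset (Site d (3 ^ k))).image (windowMap d (3 ^ k))),
        |(Matrix.of fun c c' : ↥((Finset.univ : Finset (Site d (3 ^ k))).image (windowMap d (3 ^ k))) => T c c')⁻¹ ⟨b, hb⟩ ⟨b', hb'⟩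
            - N b b'|
          ≤ (max (max c₂ 1) CN) ^ 2 * (2 * (1 - exp (-(min δ₂ ν)))⁻¹) ^ d
            * (0 * (2 * (1 - exp (-(min δ₂ ν)))⁻¹) ^ d + 2 * max C 1 * (2 * (1 - exp (-(min δ₂ ν / 2)))⁻¹) ^ d
              * (exp (-(min δ₂ ν / 2 * ((((3 ^ k : ℕ) : ℝ) - 1) / 2 - ∑ i, (((b i - (0 : X d) i).natAbs : ℕ) : ℝ))))
                + exp (-(min δ₂ ν / 2 * ((((3 ^ k : ℕ) : ℝ) - 1) / 2 - ∑ i, (((b' i - (0 : X d) i).natAbs : ℕ) : ℝ)))))) := by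
  classical
  obtain ⟨c₂, δ₂, hc₂, hδ₂, H2⟩ := kernel_section_inverse (d := d) hγ hC hδ
  refine ⟨c₂, δ₂, hc₂, hδ₂, fun T N CN ν hCN hν hTs hfloor hT hN hTN k b b' hb hb' => ?_⟩
  have hsec := H2 T hTs hfloor hT ((Finset.univ : Finset (Site d (3 ^ k))).image (windowMap d (3 ^ k)))
  have hν' : 0 < min δ₂ ν := lt_min hδ₂ hν
  have hrate : ∀ (r x : ℝ), min δ₂ ν ≤ r → 0 ≤ x → exp (-(r * x)) ≤ exp (-(min δ₂ ν * x)) := fun r x hr hx =>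
    exp_le_exp.2 (neg_le_neg (mul_le_mul_of_nonneg_right hr hx))
  have hCA : 0 ≤ max C 1 := le_trans zero_le_one (le_max_right _ _)
  have hCn : 0 ≤ max (max c₂ 1) CN := le_trans (le_trans zero_le_one (le_max_right _ _)) (le_max_left _ _)
  obtain ⟨AP, hAP⟩ : ∃ AP : X d → X d → ℝ, ∀ c c', AP c c' =
      if c ∈ (Finset.univ : Finset (Site d (3 ^ k))).image (windowMap d (3 ^ k)) ∧
        c' ∈ (Finset.univ : Finset (Site d (3 ^ k))).image (windowMap d (3 ^ k)) then T c c' else if c = c' then 1 else 0 :=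
    ⟨_, fun _ _ => rfl⟩
  obtain ⟨NP, hNP⟩ : ∃ NP : X d → X d → ℝ, ∀ c c', NP c c' =
      if h : c ∈ (Finset.univ : Finset (Site d (3 ^ k))).image (windowMap d (3 ^ k)) ∧
          c' ∈ (Finset.univ : Finset (Site d (3 ^ k))).image (windowMap d (3 ^ k))
        then (Matrix.of fun c c' : ↥((Finset.univ : Finset (Site d (3 ^ k))).image (windowMap d (3 ^ k))) => T c c')⁻¹
          ⟨c, h.1⟩ ⟨c', h.2⟩ else if c = c' then 1 else 0 := ⟨_, fun _ _ => rfl⟩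
  have hAPb : ∀ c c', |AP c c'| ≤ max C 1 := fun c c' => by rw [hAP]; exact padded_bound T _ hδ.le hT c c'
  have hTb : ∀ c c', |T c c'| ≤ max C 1 := fun c c' =>
    ((hT c c').trans (mul_le_of_le_one_right hC.le (exp_le_one_iff.2 (by rw [neg_nonpos]; positivity)))).trans (le_max_left _ _)
  have hNPd : ∀ c c', |NP c c'| ≤ max (max c₂ 1) CN * exp (-(min δ₂ ν * ∑ i, (((c i - c' i).natAbs : ℕ) : ℝ))) := by
    intro c c'
    rw [hNP]
    refine (padded_inverse_decay T _ hsec.1 c c').trans ?_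
    exact mul_le_mul (le_max_left _ _) (hrate δ₂ _ (min_le_left _ _) (by positivity)) (exp_pos _).le hCn
  have hNd : ∀ c c', |N c c'| ≤ max (max c₂ 1) CN * exp (-(min δ₂ ν * ∑ i, (((c i - c' i).natAbs : ℕ) : ℝ))) := fun c c' =>
    (hN c c').trans (mul_le_mul (le_max_right _ _) (hrate ν _ (min_le_right _ _) (by positivity)) (exp_pos _).le hCn)
  have hleft : ∀ c c', ∑' c'' : X d, NP c c'' * AP c'' c' = if c = c' then 1 else 0 := by
    intro c c'
    simp only [hNP, hAP]
    exact padded_left_inverse T _ hsec.2.2 c c'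
  have hagree : ∀ c c' : X d, ∑ i, (((c i - (0 : X d) i).natAbs : ℕ) : ℝ) ≤ (((3 ^ k : ℕ) : ℝ) - 1) / 2 →
      ∑ i, (((c' i - (0 : X d) i).natAbs : ℕ) : ℝ) ≤ (((3 ^ k : ℕ) : ℝ) - 1) / 2 → |T c c' - AP c c'| ≤ 0 := by
    intro c c' hc hc'
    rw [hAP, if_pos ⟨mem_window_of_l1_le k c hc, mem_window_of_l1_le k c' hc'⟩, sub_self, abs_zero]
  have h := inverse_ball_rate hCA hCn hν' le_rfl AP T NP N hAPb hTb hNPd hNd hleft hTN hagree b b'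
  rw [hNP, dif_pos ⟨hb, hb'⟩] at h
  exact h

/-! ## §2. THE END: torus inverses close to the decaying `ℤ^d` inverse, read through the window -/

/-- **HEADLINE — TORUS KERNELS CLOSE TO THE WINDOW READING OF A `ℤ^d` KERNEL HAVE INVERSES CLOSE TO THE `ℤ^d` DECAYING INVERSE.**
`∃ c₁ δ₁ c₂ δ₂ > 0` from `(γ_t, C_t, κ, γ_z, C_z, δ_z, C_s, δ_s, d)` such that for EVERY symmetric `ℤ^d` kernel `T` (floor `γ_z` on finite
supports, decay `C_ze^{−δ_z|b−c|₁}`), EVERY decaying `N` with `TN = 1`, every `k` and EVERY symmetric torus kernel `Tt` on `Site d (3^k)` (floor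
`γ_t`, decay `C_te^{−κρ}`) within the ROW SEAM `|Tt(y,y′) − T(wm y, wm y′)| ≤ C_se^{−δ_sω(y)}`, `ω(y) = max(0, (3^k∕2 − 2 − Σ_i|y_i|)∕2)`:
`|Tt⁻¹(y,y′) − N(wm y, wm y′)| ≤ c₁e^{−δ₁(ω y + ω y′)} +` §1's window bound at `(wm y, wm y′)` — [B4] (5.10) between `Tt` and `T∘wm` (Hyp56 for
both, Hyp59 by the geometric mean of row, column and decay bounds), `(T∘wm)⁻¹ = (T_W)⁻¹∘wm`, and §1. [folklore] -/
theorem torus_inverse_close {γt Ct κ γz Cz δz Cs δs : ℝ} (hγt : 0 < γt) (hCt : 0 < Ct) (hκ : 0 < κ) (hγz : 0 < γz) (hCz : 0 < Cz)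
    (hδz : 0 < δz) (hCs : 0 < Cs) (hδs : 0 < δs) :
    ∃ c₁ δ₁ c₂ δ₂ : ℝ, 0 < c₁ ∧ 0 < δ₁ ∧ 0 < c₂ ∧ 0 < δ₂ ∧
    ∀ (T N : X d → X d → ℝ) (CN ν : ℝ), 0 ≤ CN → 0 < ν →
      (∀ b c, T b c = T c b) →
      (∀ (S : Finset (X d)) (g : X d → ℝ), (∀ b, b ∉ S → g b = 0) →
        γz * ∑ b ∈ S, g b ^ 2 ≤ ∑ b ∈ S, g b * ∑ c ∈ S, T b c * g c) →
      (∀ b c, |T b c| ≤ Cz * exp (-(δz * ∑ i, (((b i - c i).natAbs : ℕ) : ℝ)))) →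
      (∀ b c, |N b c| ≤ CN * exp (-(ν * ∑ i, (((b i - c i).natAbs : ℕ) : ℝ)))) →
      (∀ b c, ∑' b' : X d, T b b' * N b' c = if b = c then 1 else 0) →
    ∀ (k : ℕ) (Tt : Site d (3 ^ k) → Site d (3 ^ k) → ℝ), (∀ y y', Tt y y' = Tt y' y) →
      (∀ g : Site d (3 ^ k) → ℝ, γt * ∑ y, g y ^ 2 ≤ ∑ y, g y * ∑ y', Tt y y' * g y') →
      (∀ y y', |Tt y y'| ≤ Ct * exp (-(κ * ∑ i, (((y i - y' i).valMinAbs.natAbs : ℕ) : ℝ)))) →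
      (∀ y y', |Tt y y' - T (windowMap d (3 ^ k) y) (windowMap d (3 ^ k) y')|
        ≤ Cs * exp (-(δs * max 0 ((((3 ^ k : ℕ) : ℝ) / 2 - 2 - ∑ i, ((((y i).valMinAbs).natAbs : ℕ) : ℝ)) / 2)))) →
    ∀ y y' : Site d (3 ^ k),
      |(Matrix.of fun y y' : Site d (3 ^ k) => Tt y y')⁻¹ y y' - N (windowMap d (3 ^ k) y) (windowMap d (3 ^ k) y')|
        ≤ c₁ * exp (-(δ₁ * (max 0 ((((3 ^ k : ℕ) : ℝ) / 2 - 2 - ∑ i, ((((y i).valMinAbs).natAbs : ℕ) : ℝ)) / 2)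
            + max 0 ((((3 ^ k : ℕ) : ℝ) / 2 - 2 - ∑ i, ((((y' i).valMinAbs).natAbs : ℕ) : ℝ)) / 2))))
          + (max (max c₂ 1) CN) ^ 2 * (2 * (1 - exp (-(min δ₂ ν)))⁻¹) ^ d
            * (0 * (2 * (1 - exp (-(min δ₂ ν)))⁻¹) ^ d + 2 * max Cz 1 * (2 * (1 - exp (-(min δ₂ ν / 2)))⁻¹) ^ d
              * (exp (-(min δ₂ ν / 2 * ((((3 ^ k : ℕ) : ℝ) - 1) / 2
                  - ∑ i, (((windowMap d (3 ^ k) y i - (0 : X d) i).natAbs : ℕ) : ℝ))))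
                + exp (-(min δ₂ ν / 2 * ((((3 ^ k : ℕ) : ℝ) - 1) / 2
                  - ∑ i, (((windowMap d (3 ^ k) y' i - (0 : X d) i).natAbs : ℕ) : ℝ)))))) := by
  classical
  -- the Sect. 5 letters from the common (5.6)/(5.9) constants
  have hKp : ∀ α : ℝ, 0 < α → 0 ≤ (2 * (1 - exp (-α))⁻¹) ^ d := fun α hα =>
    pow_nonneg (mul_nonneg zero_le_two (inv_nonneg.2 (sub_nonneg.2 (exp_le_one_iff.2 (by linarith))))) d
  have hγ0 : 0 < min γt γz := lt_min hγt hγz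
  obtain ⟨δ', hδ'⟩ : ∃ δ' : ℝ, δ' = min (min κ δz) δs := ⟨_, rfl⟩
  have hδ'0 : 0 < δ' := by rw [hδ']; exact lt_min (lt_min hκ hδz) hδs
  have hδ'κ : δ' ≤ κ := by rw [hδ']; exact (min_le_left _ _).trans (min_le_left _ _)
  have hδ'z : δ' ≤ δz := by rw [hδ']; exact (min_le_left _ _).trans (min_le_right _ _)
  have hδ's : δ' ≤ δs := by rw [hδ']; exact min_le_right _ _
  have hδ'3 : δ' / 3 ≤ δ' := by linarith
  obtain ⟨c₁, δ₁, hc₁, hδ₁, H5⟩ := sect5Uniform_holds (fun α => (2 * (1 - exp (-α))⁻¹) ^ d) hKp (min γt γz) (Ct + Cz + Cs) (δ' / 3)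
    hγ0 (by positivity) (by positivity)
  obtain ⟨c₂, δ₂, hc₂, hδ₂, H1⟩ := window_section_close (d := d) hγz hCz hδz
  refine ⟨c₁, δ₁, c₂, δ₂, hc₁, hδ₁, hc₂, hδ₂, ?_⟩
  intro T N CN ν hCN hν hTs hTfloor hTd hN hTN k Tt hTts hTtfloor hTtd hseam y y'
  have hρ0 : ∀ x z : Site d (3 ^ k), (0 : ℝ) ≤ ∑ i, (((x i - z i).valMinAbs.natAbs : ℕ) : ℝ) := fun x z => by positivity
  -- the window reading `Ti` of `T`, the window finset and the bijection `wm : Site ≃ W`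
  obtain ⟨Ti, hTi⟩ : ∃ Ti : Site d (3 ^ k) → Site d (3 ^ k) → ℝ, ∀ x z, Ti x z = T (windowMap d (3 ^ k) x) (windowMap d (3 ^ k) z) :=
    ⟨_, fun _ _ => rfl⟩
  have hmem : ∀ x : Site d (3 ^ k), windowMap d (3 ^ k) x ∈ (Finset.univ : Finset (Site d (3 ^ k))).image (windowMap d (3 ^ k)) :=
    fun x => Finset.mem_image_of_mem _ (Finset.mem_univ x)
  have hsurj : ∀ b : ↥((Finset.univ : Finset (Site d (3 ^ k))).image (windowMap d (3 ^ k))), ∃ x : Site d (3 ^ k),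
      windowMap d (3 ^ k) x = (b : X d) := fun b => by
    obtain ⟨x, -, hx⟩ := Finset.mem_image.1 b.2; exact ⟨x, hx⟩
  let ε : Site d (3 ^ k) ≃ ↥((Finset.univ : Finset (Site d (3 ^ k))).image (windowMap d (3 ^ k))) :=
    { toFun := fun x => ⟨windowMap d (3 ^ k) x, hmem x⟩
      invFun := fun b => siteOf d (3 ^ k) (b : X d)
      left_inv := fun x => siteOf_windowMap d (3 ^ k) x
      right_inv := fun b => Subtype.ext (by obtain ⟨x, hx⟩ := hsurj b; simp only [← hx, siteOf_windowMap]) }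
  have hεv : ∀ x, ((ε x : ↥((Finset.univ : Finset (Site d (3 ^ k))).image (windowMap d (3 ^ k)))) : X d) = windowMap d (3 ^ k) x :=
    fun x => rfl
  have hεinj : Function.Injective ε := ε.injective
  -- (5.6) for the window reading: pull-back of (236) §1 along `ε`
  have h56W := kernel_section_hyp56 T hTs hTfloor hTd ((Finset.univ : Finset (Site d (3 ^ k))).image (windowMap d (3 ^ k)))
  have h56i := hyp56_submatrix h56W hεinj
  have hsub : (Matrix.of fun b b' : ↥((Finset.univ : Finset (Site d (3 ^ k))).image (windowMap d (3 ^ k))) => T b b').submatrix ε ε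
      = Matrix.of fun x z => Ti x z := by
    ext x z; simp only [Matrix.submatrix_apply, Matrix.of_apply, hεv, hTi]
  rw [hsub] at h56i
  -- the two kernels' letters on the torus metric
  have hTi_symm : ∀ x z, Ti x z = Ti z x := fun x z => by rw [hTi, hTi]; exact hTs _ _
  have hTi_le : ∀ x z, |Ti x z| ≤ Cz * exp (-(δz * ∑ i, (((x i - z i).valMinAbs.natAbs : ℕ) : ℝ))) := fun x z => by
    rw [hTi]
    refine (hTd _ _).trans (mul_le_mul_of_nonneg_left (exp_le_exp.2 (neg_le_neg (mul_le_mul_of_nonneg_left ?_ hδz.le))) hCz.le)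
    have := torusDist_le_l1 (d := d) (3 ^ k) (windowMap d (3 ^ k) x) (windowMap d (3 ^ k) z)
    simpa only [siteOf_windowMap] using this
  -- the seam both ways (symmetry)
  have hseam' : ∀ x z, |Ti x z - Tt x z| ≤ Cs * exp (-(δs * max 0 ((((3 ^ k : ℕ) : ℝ) / 2 - 2
      - ∑ i, ((((x i).valMinAbs).natAbs : ℕ) : ℝ)) / 2))) := fun x z => by rw [abs_sub_comm, hTi]; exact hseam x z
  have hseam'' : ∀ x z, |Ti x z - Tt x z| ≤ Cs * exp (-(δs * max 0 ((((3 ^ k : ℕ) : ℝ) / 2 - 2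
      - ∑ i, ((((z i).valMinAbs).natAbs : ℕ) : ℝ)) / 2))) := fun x z => by rw [hTi_symm, hTts]; exact hseam' z x
  -- the weight `ω`: nonnegative and `ρ`-Lipschitz
  have hN0 : ∀ x : Site d (3 ^ k), ∑ i, (((x i - (0 : Site d (3 ^ k)) i).valMinAbs.natAbs : ℕ) : ℝ)
      = ∑ i, ((((x i).valMinAbs).natAbs : ℕ) : ℝ) := fun x => Finset.sum_congr rfl fun i _ => by simp
  have hω0 : ∀ x : Site d (3 ^ k), 0 ≤ max 0 ((((3 ^ k : ℕ) : ℝ) / 2 - 2 - ∑ i, ((((x i).valMinAbs).natAbs : ℕ) : ℝ)) / 2) :=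
    fun x => le_max_left _ _
  have hlip : ∀ x z : Site d (3 ^ k), max 0 ((((3 ^ k : ℕ) : ℝ) / 2 - 2 - ∑ i, ((((x i).valMinAbs).natAbs : ℕ) : ℝ)) / 2)
      ≤ ∑ i, (((x i - z i).valMinAbs.natAbs : ℕ) : ℝ)
        + max 0 ((((3 ^ k : ℕ) : ℝ) / 2 - 2 - ∑ i, ((((z i).valMinAbs).natAbs : ℕ) : ℝ)) / 2) := by
    intro x z
    have htri := (isPseudoDist_torus (d := d) (3 ^ k)).triangle z x 0
    rw [hN0 z, hN0 x, (isPseudoDist_torus (d := d) (3 ^ k)).symm z x] at htri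
    have e2 := le_max_right 0 ((((3 ^ k : ℕ) : ℝ) / 2 - 2 - ∑ i, ((((z i).valMinAbs).natAbs : ℕ) : ℝ)) / 2)
    have e3 := hρ0 x z
    exact max_le (add_nonneg e3 (le_max_left _ _)) (by linarith)
  -- (5.6) for `Tt` and for `Ti` with the common constants, (5.9) for `Ti − Tt`
  obtain ⟨Ak, hAk⟩ : ∃ Ak : Matrix (Site d (3 ^ k)) (Site d (3 ^ k)) ℝ, Ak = Matrix.of fun x z => Tt x z := ⟨_, rfl⟩
  obtain ⟨Ai, hAi⟩ : ∃ Ai : Matrix (Site d (3 ^ k)) (Site d (3 ^ k)) ℝ, Ai = Matrix.of fun x z => Ti x z := ⟨_, rfl⟩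
  have h56k : Hyp56 (fun x z : Site d (3 ^ k) => ∑ i, (((x i - z i).valMinAbs.natAbs : ℕ) : ℝ)) Ak (min γt γz) (Ct + Cz + Cs) (δ' / 3) := by
    rw [hAk]
    refine ⟨Matrix.IsSymm.ext fun x z => ?_, fun v => ?_, fun x z => ?_⟩
    · simp only [Matrix.of_apply]; exact hTts z x
    · have h := hTtfloor v
      have hv0 : 0 ≤ ∑ x, v x ^ 2 := Finset.sum_nonneg fun _ _ => sq_nonneg _
      have h2 : min γt γz * ∑ x, v x ^ 2 ≤ γt * ∑ x, v x ^ 2 := mul_le_mul_of_nonneg_right (min_le_left _ _) hv0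
      simpa only [Matrix.mulVec, dotProduct, Matrix.of_apply] using h2.trans h
    · simp only [Matrix.of_apply]
      exact decay_weaken hCt.le (by linarith) (hδ'3.trans hδ'κ) (hρ0 x z) |>.trans' (hTtd x z)
  have h56i' : Hyp56 (fun x z : Site d (3 ^ k) => ∑ i, (((x i - z i).valMinAbs.natAbs : ℕ) : ℝ)) Ai (min γt γz) (Ct + Cz + Cs) (δ' / 3) := by
    rw [hAi]
    refine ⟨Matrix.IsSymm.ext fun x z => ?_, fun v => ?_, fun x z => ?_⟩
    · simp only [Matrix.of_apply]; exact hTi_symm z x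
    · have h := h56i.2.1 v
      have hv0 : 0 ≤ ∑ x, v x ^ 2 := Finset.sum_nonneg fun _ _ => sq_nonneg _
      have h2 : min γt γz * ∑ x, v x ^ 2 ≤ γz * ∑ x, v x ^ 2 := mul_le_mul_of_nonneg_right (min_le_right _ _) hv0
      exact h2.trans h
    · simp only [Matrix.of_apply]
      exact decay_weaken hCz.le (by linarith) (hδ'3.trans hδ'z) (hρ0 x z) |>.trans' (hTi_le x z)
  have h59 : Hyp59 (fun x z : Site d (3 ^ k) => ∑ i, (((x i - z i).valMinAbs.natAbs : ℕ) : ℝ))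
      (fun x => max 0 ((((3 ^ k : ℕ) : ℝ) / 2 - 2 - ∑ i, ((((x i).valMinAbs).natAbs : ℕ) : ℝ)) / 2)) (Ai - Ak)
      (Ct + Cz + Cs) (δ' / 3) := by
    intro x z
    rw [hAi, hAk]
    simp only [Matrix.sub_apply, Matrix.of_apply]
    have s1 : |Ti x z - Tt x z| ≤ (Ct + Cz + Cs) * exp (-(δ' * ∑ i, (((x i - z i).valMinAbs.natAbs : ℕ) : ℝ))) := by
      have e1 := decay_weaken hCz.le le_rfl hδ'z (hρ0 x z) |>.trans' (hTi_le x z)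
      have e2 := decay_weaken hCt.le le_rfl hδ'κ (hρ0 x z) |>.trans' (hTtd x z)
      have e3 : 0 ≤ Cs * exp (-(δ' * ∑ i, (((x i - z i).valMinAbs.natAbs : ℕ) : ℝ))) := by positivity
      calc |Ti x z - Tt x z| ≤ |Ti x z| + |Tt x z| := abs_sub _ _
        _ ≤ Cz * exp (-(δ' * ∑ i, (((x i - z i).valMinAbs.natAbs : ℕ) : ℝ)))
            + Ct * exp (-(δ' * ∑ i, (((x i - z i).valMinAbs.natAbs : ℕ) : ℝ))) := add_le_add e1 e2
        _ ≤ (Ct + Cz + Cs) * exp (-(δ' * ∑ i, (((x i - z i).valMinAbs.natAbs : ℕ) : ℝ))) := by nlinarith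
    have hCsc : Cs ≤ Ct + Cz + Cs := by linarith
    have s2 := decay_weaken (c₀ := Ct + Cz + Cs) hCs.le hCsc hδ's (hω0 x) |>.trans' (hseam' x z)
    have s3 := decay_weaken (c₀ := Ct + Cz + Cs) hCs.le hCsc hδ's (hω0 z) |>.trans' (hseam'' x z)
    exact abs_le_of_three (by positivity) s1 s2 s3
  -- [B4] (5.10) on the coarse torus, `e = id`
  have h510 := (H5 (Site d (3 ^ k)) (fun x z : Site d (3 ^ k) => ∑ i, (((x i - z i).valMinAbs.natAbs : ℕ) : ℝ))
    (isPseudoDist_torus (3 ^ k)) (sumBound_torus (3 ^ k)) Ak h56k (Site d (3 ^ k)) id Function.injective_id).2.2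
    (Ai - Ak) (fun x => max 0 ((((3 ^ k : ℕ) : ℝ) / 2 - 2 - ∑ i, ((((x i).valMinAbs).natAbs : ℕ) : ℝ)) / 2))
    (by rw [add_sub_cancel]; exact h56i') hω0 hlip h59 y y'
  simp only [Matrix.submatrix_id_id, id, add_sub_cancel] at h510
  -- `Ai⁻¹ = (T_W)⁻¹∘wm`, and §1
  have hsubA : Ai = (Matrix.of fun b b' : ↥((Finset.univ : Finset (Site d (3 ^ k))).image (windowMap d (3 ^ k))) =>
      T b b').submatrix ε ε := by rw [hAi, hsub]
  have hinv : Ai⁻¹ y y' = (Matrix.of fun b b' : ↥((Finset.univ : Finset (Site d (3 ^ k))).image (windowMap d (3 ^ k))) =>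
      T b b')⁻¹ (ε y) (ε y') := by
    rw [hsubA, Matrix.inv_submatrix_equiv, Matrix.submatrix_apply]
  have h1 := H1 T N CN ν hCN hν hTs hTfloor hTd hN hTN k (windowMap d (3 ^ k) y) (windowMap d (3 ^ k) y') (hmem y) (hmem y')
  have e1 : |Ak⁻¹ y y' - Ai⁻¹ y y'| ≤ c₁ * exp (-(δ₁ * (max 0 ((((3 ^ k : ℕ) : ℝ) / 2 - 2
      - ∑ i, ((((y i).valMinAbs).natAbs : ℕ) : ℝ)) / 2) + max 0 ((((3 ^ k : ℕ) : ℝ) / 2 - 2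
      - ∑ i, ((((y' i).valMinAbs).natAbs : ℕ) : ℝ)) / 2)))) := by
    refine h510.trans (mul_le_mul_of_nonneg_left (exp_le_exp.2 ?_) hc₁.le)
    have := hρ0 y y'
    nlinarith
  rw [hAk] at e1
  calc |(Matrix.of fun x z : Site d (3 ^ k) => Tt x z)⁻¹ y y' - N (windowMap d (3 ^ k) y) (windowMap d (3 ^ k) y')|
      ≤ |(Matrix.of fun x z : Site d (3 ^ k) => Tt x z)⁻¹ y y' - Ai⁻¹ y y'|
        + |Ai⁻¹ y y' - N (windowMap d (3 ^ k) y) (windowMap d (3 ^ k) y')| := abs_sub_le _ _ _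
    _ ≤ _ := add_le_add e1 (by rw [hinv]; exact h1)

/-! ## §3. Toy -/

/-- Toy (`d = 1`): the letters of the abstract torus → `ℤ^d` comparison exist for unit constants. -/
example : ∃ c₁ δ₁ c₂ δ₂ : ℝ, 0 < c₁ ∧ 0 < δ₁ ∧ 0 < c₂ ∧ 0 < δ₂ :=
  let ⟨c₁, δ₁, c₂, δ₂, h1, h2, h3, h4, _⟩ := torus_inverse_close (d := 1) (γt := 1) (Ct := 1) (κ := 1) (γz := 1) (Cz := 1) (δz := 1)
    (Cs := 1) (δs := 1) one_pos one_pos one_pos one_pos one_pos one_pos one_pos one_pos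
  ⟨c₁, δ₁, c₂, δ₂, h1, h2, h3, h4⟩

end Summit.QuantumFields.BalabanUV.T4Continuum.NE7b.SupZdKernelTorusWindow
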